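import Mathlib
import HarnessLib
import Summits.HubbardSuperconductivity.HubbardSuperconductivity.Theorems.ComplexGFFStiffnessHypALocalTwoPointSecondDifferences

/-!
# Crux `HypALocalTwoPoint`, line `gnv` — difference calculus of `u ↦ Log(1 + u)` on the disc
# `‖u‖ ≤ R < 1`: Lipschitz constant `1/(1−R)`, second differences `‖u‖‖v‖/(1−R)²`

Route `route-HubbardSuperconductivity-ComplexGFFStiffness`, crux item stmt-HubbardSuperconductivity-19155,
registered stub `stub_twoPointGivenZ`, census entry (F2) of `TWOPOINT-PLAN-cgffstiff2-g0.md` §3 for the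
research statement `FreeEnergyBounds` (Theorems/ComplexGFFStiffnessDefs): the free energy is assembled as
`f(𝒦) = log κ(q(ℋ⋆)) + λ(ℋ⋆)|Λ| + Log I(𝒦)` where `I(𝒦) = ∫ (e^{−H_N} ∘ K_N)(Λ) dμ^{(q)}` is the last-scale
integral of the tuned flow, `‖I − 1‖ ≤ εη^N A⁻¹A_𝒫 ≤ R < 1` ([ABKM19] (4.11)–(4.12)).  The contribution
of the principal logarithm to the first and second DIFFERENCES of `f` is controlled here:

* `norm_log_one_add_sub_le` — `‖Log(1+u) − Log(1+u')‖ ≤ ‖u − u'‖/(1−R)` on `‖u‖, ‖u'‖ ≤ R`;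
* `norm_secondDiff_log_one_add_le` — parallelogram second differences
  `‖Log(1+a+u+v) − Log(1+a+u) − Log(1+a+v) + Log(1+a)‖ ≤ ‖u‖‖v‖/(1−R)²` (four points in the `R`-disc);
* `norm_secondDiff_log_one_add_quad_le` — the same over four ARBITRARY points of the `R/3`-disc
  (quadrilateral estimate `norm_secondDiff_quad_le`), the form consumed by the assembly: the four values
  `I(𝒦 + iU + jV)` do not form a parallelogram.

Elementary (mean value inequality for the holomorphic `Log(1+·)`, derivative `(1+u)⁻¹`); all proved,
no `sorry`.

## References
* S. Adams, S. Buchholz, R. Kotecký, S. Müller, arXiv:1910.13564, Ch. 4.2 (4.11)–(4.12), Theorem 2.2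
  [AdamsBuchholzKoteckyMuller2019].
-/

noncomputable section

-- `Summit.<Summit>.<Problem>`: single-conjunct summit, the duplicate component is mandated (D-0017).
set_option linter.dupNamespace false

namespace Summit.HubbardSuperconductivity.HubbardSuperconductivity.Theorems.ComplexGFF

open Metric Set Complex

/-! ## The derivative of `Log(1 + ·)` on the disc -/

/-- On `‖u‖ ≤ R < 1`: `‖(1+u)⁻¹‖ ≤ 1/(1−R)` (since `‖1 + u‖ ≥ 1 − ‖u‖`, the tree's
`Literature.Barriers.RiemannHypothesis.one_sub_norm_le_norm_one_add`, re-derived inline to keep the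
import list topical). -/
theorem norm_inv_one_add_le {u : ℂ} {R : ℝ} (hR : R < 1) (hu : ‖u‖ ≤ R) : ‖(1 + u)⁻¹‖ ≤ 1 / (1 - R) := by
  have h0 : 1 - ‖u‖ ≤ ‖1 + u‖ := by
    have h := norm_sub_norm_le (1 : ℂ) (-u)
    rw [sub_neg_eq_add, norm_neg, norm_one] at h
    exact h
  have h1 : 1 - R ≤ ‖1 + u‖ := le_trans (by linarith) h0
  have hpos : 0 < 1 - R := by linarith
  rw [norm_inv]
  exact (inv_le_inv₀ (lt_of_lt_of_le hpos h1) hpos).2 h1 |>.trans (le_of_eq (one_div _).symm)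

/-- `u ↦ Log(1+u)` is complex differentiable at every `u` with `‖u‖ < 1`, with derivative `(1+u)⁻¹`. -/
theorem hasDerivAt_log_one_add {u : ℂ} (hu : ‖u‖ < 1) :
    HasDerivAt (fun u : ℂ => Complex.log (1 + u)) (1 + u)⁻¹ u := by
  have hslit : 1 + u ∈ slitPlane := mem_slitPlane_of_norm_lt_one hu
  have h := ((hasDerivAt_id u).const_add (1 : ℂ)).clog (by simpa using hslit)
  simpa [one_div] using h

/-! ## First differences -/

/-- **Lipschitz bound of `Log(1+·)` on the disc `‖u‖ ≤ R < 1`**: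
`‖Log(1+u) − Log(1+u')‖ ≤ ‖u − u'‖/(1−R)`. -/
theorem norm_log_one_add_sub_le {R : ℝ} (hR : R < 1) {u u' : ℂ} (hu : ‖u‖ ≤ R) (hu' : ‖u'‖ ≤ R) :
    ‖Complex.log (1 + u) - Complex.log (1 + u')‖ ≤ 1 / (1 - R) * ‖u - u'‖ := by
  have hconv : Convex ℝ (closedBall (0 : ℂ) R) := convex_closedBall _ _
  have hmem : ∀ {z : ℂ}, z ∈ closedBall (0 : ℂ) R ↔ ‖z‖ ≤ R := by intro z; simp
  have hdiff : ∀ z ∈ closedBall (0 : ℂ) R, DifferentiableAt ℂ (fun u : ℂ => Complex.log (1 + u)) z :=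
    fun z hz => (hasDerivAt_log_one_add (lt_of_le_of_lt (hmem.1 hz) hR)).differentiableAt
  have hbound : ∀ z ∈ closedBall (0 : ℂ) R, ‖deriv (fun u : ℂ => Complex.log (1 + u)) z‖ ≤ 1 / (1 - R) :=
    fun z hz => by
      rw [(hasDerivAt_log_one_add (lt_of_le_of_lt (hmem.1 hz) hR)).deriv]
      exact norm_inv_one_add_le hR (hmem.1 hz)
  exact hconv.norm_image_sub_le_of_norm_deriv_le hdiff hbound (hmem.2 hu') (hmem.2 hu)

/-! ## Second differences -/

/-- **Parallelogram second differences of `Log(1+·)` on the disc `‖·‖ ≤ R < 1`**: for `a, a+u, a+v,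
a+u+v` in the disc, `‖Log(1+a+u+v) − Log(1+a+u) − Log(1+a+v) + Log(1+a)‖ ≤ ‖u‖‖v‖/(1−R)²`.  (The map
`x ↦ Log(1+x+v) − Log(1+x)` has derivative `(1+x+v)⁻¹ − (1+x)⁻¹ = −v(1+x+v)⁻¹(1+x)⁻¹`, of norm
`≤ ‖v‖/(1−R)²`, on the convex set where `x` and `x+v` lie in the disc.) -/
theorem norm_secondDiff_log_one_add_le {R : ℝ} (hR : R < 1) {a u v : ℂ} (ha : ‖a‖ ≤ R)
    (hau : ‖a + u‖ ≤ R) (hav : ‖a + v‖ ≤ R) (hauv : ‖a + u + v‖ ≤ R) :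
    ‖Complex.log (1 + (a + u + v)) - Complex.log (1 + (a + u)) - Complex.log (1 + (a + v))
        + Complex.log (1 + a)‖ ≤ 1 / (1 - R) ^ 2 * ‖u‖ * ‖v‖ := by
  have hpos : 0 < 1 - R := by linarith
  -- the convex set where `x` and `x + v` lie in the disc
  set s : Set ℂ := closedBall (0 : ℂ) R ∩ closedBall (-v) R with hs
  have hconv : Convex ℝ s := (convex_closedBall _ _).inter (convex_closedBall _ _)
  have hmem : ∀ {z : ℂ}, z ∈ s ↔ ‖z‖ ≤ R ∧ ‖z + v‖ ≤ R := by
    intro z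
    simp only [hs, mem_inter_iff, mem_closedBall, dist_eq_norm, sub_zero, sub_neg_eq_add]
  set φ : ℂ → ℂ := fun x => Complex.log (1 + (x + v)) - Complex.log (1 + x) with hφ
  have hderiv : ∀ x ∈ s, HasDerivAt φ ((1 + (x + v))⁻¹ - (1 + x)⁻¹) x := by
    intro x hx
    obtain ⟨hx1, hx2⟩ := hmem.1 hx
    have h1 : HasDerivAt (fun x : ℂ => Complex.log (1 + (x + v))) ((1 + (x + v))⁻¹) x := by
      have hslit : 1 + (x + v) ∈ slitPlane := mem_slitPlane_of_norm_lt_one (lt_of_le_of_lt hx2 hR)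
      have h := (((hasDerivAt_id x).add_const v).const_add (1 : ℂ)).clog (by simpa using hslit)
      simpa [one_div] using h
    exact h1.sub (hasDerivAt_log_one_add (lt_of_le_of_lt hx1 hR))
  have hdiff : ∀ x ∈ s, DifferentiableAt ℂ φ x := fun x hx => (hderiv x hx).differentiableAt
  have hbound : ∀ x ∈ s, ‖deriv φ x‖ ≤ 1 / (1 - R) ^ 2 * ‖v‖ := by
    intro x hx
    obtain ⟨hx1, hx2⟩ := hmem.1 hx
    rw [(hderiv x hx).deriv]
    have hne : ∀ y : ℂ, ‖y‖ ≤ R → (1 + y) ≠ 0 := by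
      intro y hy h0
      have h := norm_sub_norm_le (1 : ℂ) (-y)
      rw [sub_neg_eq_add, norm_neg, norm_one, h0, norm_zero] at h
      linarith
    have hne1 : (1 + (x + v)) ≠ 0 := hne _ hx2
    have hne2 : (1 + x) ≠ 0 := hne _ hx1
    have e : (1 + (x + v))⁻¹ - (1 + x)⁻¹ = -(v * ((1 + (x + v))⁻¹ * (1 + x)⁻¹)) := by
      field_simp
      ring
    rw [e, norm_neg, norm_mul, norm_mul]
    have h1 := norm_inv_one_add_le hR hx2
    have h2 := norm_inv_one_add_le hR hx1
    calc ‖v‖ * (‖(1 + (x + v))⁻¹‖ * ‖(1 + x)⁻¹‖) ≤ ‖v‖ * (1 / (1 - R) * (1 / (1 - R))) := by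
          refine mul_le_mul_of_nonneg_left ?_ (norm_nonneg _)
          exact mul_le_mul h1 h2 (norm_nonneg _) (by positivity)
      _ = 1 / (1 - R) ^ 2 * ‖v‖ := by field_simp
  have has : a ∈ s := hmem.2 ⟨ha, hav⟩
  have haus : a + u ∈ s := hmem.2 ⟨hau, hauv⟩
  have h := hconv.norm_image_sub_le_of_norm_deriv_le hdiff hbound has haus
  have e : φ (a + u) - φ a = Complex.log (1 + (a + u + v)) - Complex.log (1 + (a + u))
      - Complex.log (1 + (a + v)) + Complex.log (1 + a) := by
    simp only [hφ]; ring
  rw [e, add_sub_cancel_left] at h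
  calc _ ≤ 1 / (1 - R) ^ 2 * ‖v‖ * ‖u‖ := h
    _ = 1 / (1 - R) ^ 2 * ‖u‖ * ‖v‖ := by ring

/-- **Second differences of `Log(1+·)` over four arbitrary points**: for `a₀₀, a₁₀, a₀₁` in the
`R/3`-disc and `a₁₁` in the `R`-disc (`R < 1`),
`‖Log(1+a₁₁) − Log(1+a₁₀) − Log(1+a₀₁) + Log(1+a₀₀)‖ ≤ (1/(1−R))‖a₁₁ − a₁₀ − a₀₁ + a₀₀‖
  + (1/(1−R)²)‖a₁₀ − a₀₀‖‖a₀₁ − a₀₀‖` — the quadrilateral estimate for `Log(1+·)`. -/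
theorem norm_secondDiff_log_one_add_quad_le {R : ℝ} (hR : R < 1) {a₀₀ a₁₀ a₀₁ a₁₁ : ℂ}
    (h₀₀ : ‖a₀₀‖ ≤ R / 3) (h₁₀ : ‖a₁₀‖ ≤ R / 3) (h₀₁ : ‖a₀₁‖ ≤ R / 3) (h₁₁ : ‖a₁₁‖ ≤ R) :
    ‖Complex.log (1 + a₁₁) - Complex.log (1 + a₁₀) - Complex.log (1 + a₀₁) + Complex.log (1 + a₀₀)‖
      ≤ 1 / (1 - R) * ‖a₁₁ - a₁₀ - a₀₁ + a₀₀‖ + 1 / (1 - R) ^ 2 * ‖a₁₀ - a₀₀‖ * ‖a₀₁ - a₀₀‖ :=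
  norm_secondDiff_quad_le (g := fun u : ℂ => Complex.log (1 + u)) (R := R)
    (fun _ _ hha hhb => norm_log_one_add_sub_le hR hha hhb)
    (fun _ _ _ hha hau hav hauv => norm_secondDiff_log_one_add_le hR hha hau hav hauv) h₀₀ h₁₀ h₀₁ h₁₁

end Summit.HubbardSuperconductivity.HubbardSuperconductivity.Theorems.ComplexGFF

end
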